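import Literature.NumberTheory.FaltingsSerre.GSp4F2Iso
import Literature.NumberTheory.FaltingsSerre.SymplecticLift
import HarnessLib

/-!
# The residual image of a `GSp(J)`-valued `ρ : G → GL₄(ℤ₂)` lies in `ι(S₆) = Sp₄(𝔽₂)`

[BPPTVY] = A. Brumer, A. Pacetti, C. Poor, G. Tornaría, J. Voight, D. S. Yuen, *On the paramodularity of
typical abelian surfaces*, Algebra & Number Theory **13**:5 (2019) 1145–1195 [cite: BrumerEtAl2019].

[BPPTVY, §2.1 p. 1150 and §5.1 p. 1173]: for `G = GSp₄` the residual representation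
`ρ̄ = ρ mod 2 : Gal_{F,S} → GSp₄(𝔽₂)`, and "`GSp₄(𝔽₂) = Sp₄(𝔽₂)`" (the multiplier lands in `𝔽₂ˣ = {1}`),
which [BPPTVY, (5.1.1)–(5.1.2)] identify with `S₆` via `ι`.  This file supplies the kernel-checked form of
that remark which the one-stop re-framing theorems of `ResidualReframe.lean`
(`exists_reframe_of_transvection`, `…_of_trace_orderThree`, `…_of_range_S3wrS2`) take as the hypotheses
`hSp₁`, `hSp₂ : (residual ρᵢ).range ≤ iotaGL.range`: they follow from the certificate's OWN fields
`similitude₁`, `similitude₂` (`∀ σ, IsSimilitude J (ν σ) (ρᵢ σ)`, schema `ParamodularCertificate.lean`)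
for `J = antiIdAlt4 ℤ_[2]` — with NO hypothesis on the multiplier `ν` (if `ν(σ) mod 2` were `0` then
`ρ̄(σ)ᵀ J̄ ρ̄(σ) = 0` with `ρ̄(σ)` invertible and `det J̄ = 1`, absurd).

* `symplectic_residual_of_isSimilitude` — `IsSimilitude (antiIdAlt4 ℤ₂) c g` ⇒
  `ḡᵀ · antiId4 𝔽₂ · ḡ = antiId4 𝔽₂` for `ḡ = GL₄(PadicInt.toZMod) g`;
* `residual_mem_range_iotaGL_of_isSimilitude`, `range_residual_le_iotaGL_of_isSimilitude` (for a
  homomorphism `ρ : G →* GL₄(ℤ₂)`), `FramedRep.range_residual_le_iotaGL` (for a `FramedRep`, the shape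
  of the schema fields).
-/

namespace Literature.NumberTheory.FaltingsSerre.GSp4F2

open Matrix Equiv Equiv.Perm Literature.NumberTheory.GaloisRepresentations

/-- `det (antiId4 𝔽₂) = 1`. [cite: BrumerEtAl2019, (5.1.2) p. 1173] -/
theorem det_antiId4_zmod2 : (antiId4 (ZMod 2)).det = 1 := by
  rw [← antiIdAlt4_zmod2]; exact det_antiIdAlt4 (ZMod 2)

/-- Entrywise reduction of a scalar multiple. [folklore] -/
theorem map_smul_toZMod (c : ℤ_[2]) (M : Matrix (Fin 4) (Fin 4) ℤ_[2]) :
    (c • M).map (PadicInt.toZMod (p := 2)) = PadicInt.toZMod (p := 2) c • M.map (PadicInt.toZMod (p := 2)) := by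
  ext i j
  simp [Matrix.map_apply, Matrix.smul_apply]

/-- **`GSp₄(ℤ₂)` reduces into `Sp₄(𝔽₂)`** [BPPTVY, §2.1 p. 1150: "`ρ̄ : Gal → GSp₄(𝔽₂) = Sp₄(𝔽₂)`"]: if
`gᵀ J g = c J` with `J = antiIdAlt4 ℤ_[2]` and `g ∈ GL₄(ℤ₂)`, then the reduction `ḡ` satisfies
`ḡᵀ J̄ ḡ = J̄` with `J̄ = antiId4 𝔽₂` — whatever `c` is (`c mod 2 = 0` is impossible since `ḡ` is
invertible and `det J̄ = 1`). [cite: BrumerEtAl2019, §2.1 p. 1150 and (5.1.2) p. 1173] -/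
theorem symplectic_residual_of_isSimilitude (g : GL (Fin 4) ℤ_[2]) {c : ℤ_[2]}
    (h : IsSimilitude (antiIdAlt4 ℤ_[2]) c (g : Matrix (Fin 4) (Fin 4) ℤ_[2])) :
    ((Matrix.GeneralLinearGroup.map (PadicInt.toZMod (p := 2)) g : GL (Fin 4) (ZMod 2)) :
        Matrix (Fin 4) (Fin 4) (ZMod 2))ᵀ * antiId4 (ZMod 2) *
      ((Matrix.GeneralLinearGroup.map (PadicInt.toZMod (p := 2)) g : GL (Fin 4) (ZMod 2)) :
        Matrix (Fin 4) (Fin 4) (ZMod 2)) = antiId4 (ZMod 2) := by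
  set gbar : GL (Fin 4) (ZMod 2) := Matrix.GeneralLinearGroup.map (PadicInt.toZMod (p := 2)) g
    with hgbar
  have hcoe : (gbar : Matrix (Fin 4) (Fin 4) (ZMod 2)) =
      (g : Matrix (Fin 4) (Fin 4) ℤ_[2]).map (PadicInt.toZMod (p := 2)) := rfl
  have h1 : (gbar : Matrix (Fin 4) (Fin 4) (ZMod 2))ᵀ * antiId4 (ZMod 2) * gbar =
      PadicInt.toZMod (p := 2) c • antiId4 (ZMod 2) := by
    have := congrArg (fun A : Matrix (Fin 4) (Fin 4) ℤ_[2] => A.map (PadicInt.toZMod (p := 2))) h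
    simpa only [Matrix.map_mul, Matrix.transpose_map, antiIdAlt4_map_toZMod, map_smul_toZMod,
      ← hcoe] using this
  have h01 : ∀ x : ZMod 2, x = 0 ∨ x = 1 := by decide
  rcases h01 (PadicInt.toZMod (p := 2) c) with hc | hc
  · exfalso
    rw [hc, zero_smul] at h1
    have hdet : IsUnit (gbar : Matrix (Fin 4) (Fin 4) (ZMod 2)).det := Matrix.isUnits_det_units gbar
    have h2 := congrArg Matrix.det h1
    rw [Matrix.det_mul, Matrix.det_mul, Matrix.det_transpose, det_antiId4_zmod2, mul_one,
      Matrix.det_zero, mul_self_eq_zero] at h2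
    exact hdet.ne_zero h2
  · rwa [hc, one_smul] at h1

variable {G : Type*} [Group G]

/-- `ρ̄(σ) ∈ ι(S₆) = Sp₄(𝔽₂)` for a similitude-valued `ρ` (`mem_range_iotaGL`: `ι(S₆)` IS `Sp₄(𝔽₂)`).
[cite: BrumerEtAl2019, §2.1 p. 1150 and (5.1.1)–(5.1.2) p. 1173] -/
theorem residual_mem_range_iotaGL_of_isSimilitude (ρ : G →* GL (Fin 4) ℤ_[2]) (σ : G) {c : ℤ_[2]}
    (h : IsSimilitude (antiIdAlt4 ℤ_[2]) c ((ρ σ : GL (Fin 4) ℤ_[2]) : Matrix (Fin 4) (Fin 4) ℤ_[2])) :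
    residual ρ σ ∈ iotaGL.range :=
  (mem_range_iotaGL _).2 (symplectic_residual_of_isSimilitude (ρ σ) h)

/-- **The residual image of a `GSp(J)`-valued `ρ : G → GL₄(ℤ₂)` lies in `ι(S₆)`** — the hypothesis
`hSp` of the one-stop re-framing theorems, from the similitude field of the certificate schema
(`∀ σ, IsSimilitude J (ν σ) (ρ σ)`, any multiplier function `ν`). [cite: BrumerEtAl2019, §2.1 p. 1150 and (5.1.2) p. 1173] -/
theorem range_residual_le_iotaGL_of_isSimilitude (ρ : G →* GL (Fin 4) ℤ_[2]) (ν : G → ℤ_[2])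
    (h : ∀ σ, IsSimilitude (antiIdAlt4 ℤ_[2]) (ν σ)
      ((ρ σ : GL (Fin 4) ℤ_[2]) : Matrix (Fin 4) (Fin 4) ℤ_[2])) :
    (residual ρ).range ≤ iotaGL.range := by
  rintro _ ⟨σ, rfl⟩
  exact residual_mem_range_iotaGL_of_isSimilitude ρ σ (h σ)

/-- The same for a framed (continuous) representation `ρ : FramedRep G ℤ_[2] 4` — literally the shape of
the fields `similitude₁`/`similitude₂` of `Certificate` with `J := antiIdAlt4 ℤ_[2]`. [cite: BrumerEtAl2019, §2.1 p. 1150 and (5.1.2) p. 1173] -/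
theorem range_residual_le_iotaGL_framed [TopologicalSpace G] (ρ : FramedRep G ℤ_[2] 4)
    (ν : G → ℤ_[2])
    (h : ∀ σ, IsSimilitude (antiIdAlt4 ℤ_[2]) (ν σ)
      ((ρ σ : GL (Fin 4) ℤ_[2]) : Matrix (Fin 4) (Fin 4) ℤ_[2])) :
    (residual ρ.toMonoidHom).range ≤ iotaGL.range :=
  range_residual_le_iotaGL_of_isSimilitude ρ.toMonoidHom ν h

end Literature.NumberTheory.FaltingsSerre.GSp4F2
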